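import Mathlib
import Literature.FieldTheory.RealClosed.TraceFormRealRooted
import HarnessLib

/-!
# Trace forms of real-rooted families: `Tr_{L|K}(y²)` is a non-negative polynomial over a square

Topic `Literature/FieldTheory/RealClosed`. C. Hanselka, J. Algebra 487 (2017) 340–356, §3
(Cor. 3.1 with Remark 3.2(b)) and §5 ("These must be positive as follows easily from Sylvester's
Lemma"): for `f ∈ ℝ[x][t]` monic and REAL ROOTED (every fibre `f(a,·)`, `a ∈ ℝ`, has all its
roots real) and `L = K[t]/(f)`, `K = ℝ(x)`, the trace form `y ↦ Tr_{L|K}(y²)` is non-negative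
"at every real point". We prove this in the denominator-explicit form needed for Gram matrices
with entries in `ℝ[x]` (no evaluation of rational functions):

* `trace_adjoinRoot_map` — base change of the trace of `A[t]/(f)` (`f` monic) along any ring
  map `φ : A → R`: `Tr_{R[t]/(f^φ)|R}(r^φ) = φ(Tr_{A[t]/(f)|A}(r))` (both algebras have the power
  basis `1, t, …, t^{n-1}` and the same multiplication table) [folklore];
* `exists_sq_mul_trace_mul_self_eq` — for every `y ∈ L` there are `P, D ∈ ℝ[x]`, `D ≠ 0`,
  with `D² · Tr_{L|K}(y²) = P` in `K` and `P(a) ≥ 0` for all real `a` [cite: Hanselka2017,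
  Cor. 3.1/§5]: clear denominators (`D y = r(t̄)`, `r ∈ ℝ[x][t]`), `P := Tr_{ℝ[x][t]/(f)|ℝ[x]}(r²)`,
  and `P(a) = Tr_{ℝ[t]/(f(a,·))|ℝ}(r(a,·)²) ≥ 0` by the Sylvester–Hermite lemma
  (`trace_mul_self_nonneg_of_card_roots_eq`, `TraceFormRealRooted.lean`).

Here `L` is any commutative `K`-algebra with a power basis whose generator has minimal polynomial
`f` (e.g. `K[t]/(f)` itself), `K` any field of fractions of `ℝ[x]`.

## References

* [Hanselka2017] C. Hanselka, J. Algebra 487 (2017) 340–356: Lemma 1.1, Cor. 3.1, Rem. 3.2(b),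
  §5.
-/

noncomputable section

open Polynomial

namespace Literature.FieldTheory.RealClosed

/-- Trace of a reindexed square matrix. [folklore] -/
theorem matrix_trace_reindex {R m n : Type*} [AddCommMonoid R] [Fintype m] [Fintype n]
    (e : m ≃ n) (M : Matrix m m R) : Matrix.trace (Matrix.reindex e e M) = Matrix.trace M := by
  simp only [Matrix.trace, Matrix.diag, Matrix.reindex_apply, Matrix.submatrix_apply]
  exact Fintype.sum_equiv e.symm _ _ fun _ => rfl

/-- **Base change of the trace of `A[t]/(f)`, `f` monic.** For a ring map `φ : A → R` and
`r ∈ A[t]`, `Tr_{R[t]/(f^φ) | R}(r^φ) = φ (Tr_{A[t]/(f) | A}(r))`. [folklore] -/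
theorem trace_adjoinRoot_map {A R : Type*} [CommRing A] [CommRing R] (φ : A →+* R) {f : A[X]}
    (hf : f.Monic) (r : A[X]) :
    Algebra.trace R (AdjoinRoot (f.map φ)) (AdjoinRoot.mk (f.map φ) (r.map φ)) =
      φ (Algebra.trace A (AdjoinRoot f) (AdjoinRoot.mk f r)) := by
  classical
  nontriviality R
  have hfφ : (f.map φ).Monic := hf.map φ
  have hn : (f.map φ).natDegree = f.natDegree := hf.natDegree_map φ
  -- the power bases `1, t, …, t^{n-1}`, over `R` reindexed to `Fin f.natDegree`
  let bA : Module.Basis (Fin f.natDegree) A (AdjoinRoot f) := AdjoinRoot.powerBasisAux' hf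
  let bR : Module.Basis (Fin f.natDegree) R (AdjoinRoot (f.map φ)) :=
    (AdjoinRoot.powerBasisAux' hfφ).reindex (finCongr hn)
  have hbA : ∀ i : Fin f.natDegree, bA i = AdjoinRoot.mk f (X ^ (i : ℕ)) := fun i => by
    have h := congr_fun (PowerBasis.coe_basis (AdjoinRoot.powerBasis' hf)) i
    rw [AdjoinRoot.powerBasis'_gen, ← AdjoinRoot.mk_X, ← map_pow] at h
    exact h
  have hbR : ∀ j : Fin f.natDegree, bR j = AdjoinRoot.mk (f.map φ) (X ^ (j : ℕ)) := fun j => by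
    have h := congr_fun (PowerBasis.coe_basis (AdjoinRoot.powerBasis' hfφ)) ((finCongr hn).symm j)
    rw [AdjoinRoot.powerBasis'_gen, ← AdjoinRoot.mk_X, ← map_pow, finCongr_symm, finCongr_apply,
      Fin.val_cast] at h
    rw [show bR j = AdjoinRoot.powerBasisAux' hfφ ((finCongr hn).symm j) from
      Module.Basis.reindex_apply _ _ _]
    exact h
  have hmat : Algebra.leftMulMatrix bR (AdjoinRoot.mk (f.map φ) (r.map φ)) =
      (Algebra.leftMulMatrix bA (AdjoinRoot.mk f r)).map φ := by
    ext i j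
    rw [Matrix.map_apply, Algebra.leftMulMatrix_eq_repr_mul, Algebra.leftMulMatrix_eq_repr_mul,
      hbA, hbR, ← map_mul, ← map_mul, Module.Basis.repr_reindex_apply,
      AdjoinRoot.powerBasisAux'_repr_apply_to_fun, AdjoinRoot.powerBasisAux'_repr_apply_to_fun,
      AdjoinRoot.modByMonicHom_mk, AdjoinRoot.modByMonicHom_mk, finCongr_symm, finCongr_apply,
      Fin.val_cast, ← Polynomial.map_X φ, ← Polynomial.map_pow, ← Polynomial.map_mul,
      ← map_modByMonic φ hf, coeff_map]
  rw [Algebra.trace_eq_matrix_trace bR, Algebra.trace_eq_matrix_trace bA, hmat]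
  exact (AddMonoidHom.map_trace φ _).symm

/-- **`Tr_{L|K}(y²)` is a non-negative polynomial over a square** ([Hanselka2017, Cor. 3.1
with Rem. 3.2(b); the positivity step of §5]): let `f ∈ ℝ[x][t]` be monic and real rooted, `K` a
field of fractions of `ℝ[x]`, and `L` a commutative `K`-algebra with a power basis whose
generator has minimal polynomial `f`. Then for every `y ∈ L` there are `P, D ∈ ℝ[x]` with
`D ≠ 0`, `P(a) ≥ 0` for all real `a`, and `D² · Tr_{L|K}(y²) = P`.
[cite: Hanselka2017, Cor. 3.1 and §5 (positivity of the scaled trace form)] -/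
theorem exists_sq_mul_trace_mul_self_eq {K L : Type*} [Field K] [CommRing L]
    [Algebra ℝ[X] K] [IsFractionRing ℝ[X] K] [Algebra K L]
    {f : ℝ[X][X]} (hf : f.Monic)
    (hroots : ∀ a : ℝ, Multiset.card (f.map (evalRingHom a)).roots = f.natDegree)
    (pb : PowerBasis K L) (hpb : minpoly K pb.gen = f.map (algebraMap ℝ[X] K)) (y : L) :
    ∃ P D : ℝ[X], D ≠ 0 ∧ (∀ a : ℝ, 0 ≤ P.eval a) ∧
      algebraMap ℝ[X] K (D ^ 2) * Algebra.trace K L (y * y) = algebraMap ℝ[X] K P := by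
  classical
  set fK : K[X] := f.map (algebraMap ℝ[X] K) with hfK
  have hfKm : fK.Monic := hf.map _
  -- `y = q(gen)`, clear the denominators of `q`
  obtain ⟨q, rfl⟩ := pb.exists_eq_aeval' y
  obtain ⟨D, hD, hr⟩ := IsLocalization.integerNormalization_spec (nonZeroDivisors ℝ[X]) (S := K) q
  set r : ℝ[X][X] := IsLocalization.integerNormalization (nonZeroDivisors ℝ[X]) q with hrdef
  have hD0 : D ≠ 0 := nonZeroDivisors.ne_zero hD
  -- `u := r(gen) = D • q(gen)`
  have hu : aeval pb.gen (r.map (algebraMap ℝ[X] K)) =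
      algebraMap K L (algebraMap ℝ[X] K D) * aeval pb.gen q := by
    rw [hr, Algebra.smul_def, map_mul, Polynomial.algebraMap_apply, aeval_C]
  -- the transport `L ≃ K[t]/(fK)`
  let pb' : PowerBasis K (AdjoinRoot fK) := AdjoinRoot.powerBasis' hfKm
  have hmin : minpoly K pb.gen = minpoly K pb'.gen := by
    rw [hpb]
    change fK = minpoly K (AdjoinRoot.root fK)
    rw [AdjoinRoot.minpoly_root hfKm.ne_zero, hfKm.leadingCoeff, inv_one, C_1, mul_one]
  let e : L ≃ₐ[K] AdjoinRoot fK := pb.equivOfMinpoly pb' hmin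
  have he : ∀ s : K[X], e (aeval pb.gen s) = AdjoinRoot.mk fK s := fun s => by
    rw [PowerBasis.equivOfMinpoly_aeval]
    change aeval (AdjoinRoot.root fK) s = _
    rw [AdjoinRoot.aeval_eq]
  -- `P`
  refine ⟨Algebra.trace ℝ[X] (AdjoinRoot f) (AdjoinRoot.mk f (r * r)), D, hD0, ?_, ?_⟩
  · intro a
    have h := trace_adjoinRoot_map (evalRingHom a) hf (r * r)
    rw [coe_evalRingHom] at h
    rw [← h, Polynomial.map_mul, map_mul]
    exact trace_mul_self_nonneg_of_card_roots_eq (hf.map _)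
      (by rw [hroots a, hf.natDegree_map]) _
  · have h1 : e (aeval pb.gen (r.map (algebraMap ℝ[X] K)) * aeval pb.gen (r.map (algebraMap ℝ[X] K))) =
        AdjoinRoot.mk fK ((r * r).map (algebraMap ℝ[X] K)) := by
      rw [map_mul, he, Polynomial.map_mul, map_mul]
    have htr : Algebra.trace K L
        (aeval pb.gen (r.map (algebraMap ℝ[X] K)) * aeval pb.gen (r.map (algebraMap ℝ[X] K))) =
        algebraMap ℝ[X] K (Algebra.trace ℝ[X] (AdjoinRoot f) (AdjoinRoot.mk f (r * r))) := by
      rw [← Algebra.trace_eq_of_algEquiv e, h1, hfK, trace_adjoinRoot_map (algebraMap ℝ[X] K) hf]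
    rw [← htr, hu]
    set c := algebraMap ℝ[X] K D
    set z := aeval pb.gen q
    have : algebraMap K L c * z * (algebraMap K L c * z) = (c ^ 2) • (z * z) := by
      rw [Algebra.smul_def, map_pow]
      ring
    rw [this, map_smul, smul_eq_mul, map_pow]

end Literature.FieldTheory.RealClosed
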